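import Mathlib.GroupTheory.Archimedean
import Literature.Algebra.EuclideanLattices.DualLattice
import Literature.Algebra.EuclideanLattices.PQCLLLProofs
import Literature.Analysis.InnerProduct.GramSchmidt
import HarnessLib

/-!
# The volume of a lattice slice: `vol(Λ ∩ v⊥) = ‖v‖ · vol(Λ)` for `v` primitive in `Λ*` (DDGR20 Lemma 12)

Topic `Literature/Algebra/EuclideanLattices`; namespace `Literature.Algebra.EuclideanLattices`. PUBLISHED RESULT, here
PROVED (two definitions with bodies — `IsPrimitiveVector`, `slice` — and theorems; 0 named facts, 0 sorry).

**Statement** ([DachmanSoledDucasGongRossi2020] = ePrint 2020/292 full version, §2 Lemma 12 «Volume of a lattice slice»;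
restated as [DucasVanwoerden2021] Lemma 3.2): «Given a lattice `Λ` with volume `Vol(Λ)`, and a primitive vector `v` with
respect to `Λ*`. Let `v⊥` denote subspace orthogonal to `v`. Then `Λ ∩ v⊥` is a lattice with volume
`Vol(Λ ∩ v⊥) = ‖v‖ · Vol(Λ)`.» Here (ibid. §2 preliminaries, p. 6) `Λ* := {y ∈ Span(B) | ∀ x ∈ Λ, ⟨x, y⟩ ∈ ℤ}`
(the tree's `dualLattice`, `DualLattice.lean`), and (Definition 11, `k = 1`) a vector `y ∈ Λ` is *primitive* w.r.t. `Λ`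
iff «`y/i ∉ Λ` for any integer `i ≥ 2`» (equivalently: it extends to a basis of `Λ`).

What is typed (for a full-rank `ℤ`-lattice `L` of a finite-dimensional real inner product space `E`):
* `IsPrimitiveVector Λ y` — Definition 11 for one vector, as printed (`y ∈ Λ ∧ ∀ i ≥ 2, i⁻¹ • y ∉ Λ`);
* `slice L v : Submodule ℤ ↥(ℝ ∙ v)ᗮ` — the slice `L ∩ v⊥`, as a `ℤ`-submodule of the hyperplane `v⊥ = (ℝ ∙ v)ᗮ`
  (itself a real inner product space, carrying its own Lebesgue measure `volume`); `mem_slice`;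
* `discreteTopology_slice` — it is discrete; `isZLattice_slice` — for `v ∈ L*`, `v ≠ 0` it has full rank in `v⊥`
  («`Λ ∩ v⊥` is a lattice» of dimension `n − 1`; primitivity is not needed for this part);
* `exists_inner_eq_one_of_isPrimitiveVector` — for `v` primitive in `L*`: `⟨v, L⟩ = ℤ`, i.e. some `x ∈ L` has
  `⟪v, x⟫ = 1` (the step «let `ℓ` be such that `⟨v̄, Λ⟩ = ℓℤ` … by primitivity of `v̄`, we have `ℓ = 1`» of the
  proof of the paper's Lemma 13);
* `covolume_slice` — **Lemma 12**: `covolume (slice L v) = ‖v‖ * covolume L`, under `v ∈ L*` and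
  `∃ x ∈ L, ⟪v, x⟫ = 1`; `covolume_slice_of_isPrimitiveVector` — the same under Definition 11's hypothesis.
* `sparsify L v k`, `covolume_sparsify` — **Lemma 13** (volume of a sparsified lattice): for `v ∈ L*` with
  `⟨v, L⟩ = ℤ` and `k > 0`, `Λ' = {x ∈ Λ | ⟨x, v⟩ ≡ 0 mod k}` is a full-rank sublattice with `vol(Λ') = k · vol(Λ)`
  (proof as printed: `Λ' = ker(x ↦ ⟨x, v⟩ mod k)`, index `k`, and Mathlib's `ZLattice.covolume_div_covolume_eq_relIndex'`).

**Proof.** The paper proves Lemma 12 by duality (its Lemma 9 = [Martinet] Prop. 1.3.4, `(Λ ∩ F)* = π_F(Λ*)`, and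
Lemma 10 = [Martinet] Prop. 1.2.9, `Vol(π_{F⊥}(Λ)) = Vol(Λ)/Vol(Λ ∩ F)`). Mathlib has neither the dual of a section
nor volumes of projected lattices, so we take the shorter direct road (a standard unimodular-complement argument,
recorded here as a deviation from the printed proof): pick `x₁ ∈ L` with `⟪v, x₁⟫ = 1`; then
`x ↦ x − ⟪v, x⟫ x₁` retracts `L` onto `L ∩ v⊥`, so a `ℤ`-basis `k₁, …, k_{n-1}` of the slice together with `x₁`
is a `ℤ`-basis of `L`, and by the Gram–Schmidt volume formula (`covolume_latticeOfBasis_eq_prod_norm_gramSchmidt`,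
Cohen GTM 138 Prop. 2.5.4) `vol(L) = (∏ ‖k*ᵢ‖) · ‖x₁*‖ = vol(L ∩ v⊥) · dist(x₁, v⊥) = vol(L ∩ v⊥) · ⟪v, x₁⟫/‖v‖
= vol(L ∩ v⊥)/‖v‖`. The rank statement is the dimension count `E = span(L) ⊆ span(L ∩ v⊥) + ℝ y` for any
`y ∈ L` with `⟪v, y⟫ ≠ 0`.

## References
* [DachmanSoledDucasGongRossi2020] D. Dachman-Soled, L. Ducas, H. Gong, M. Rossi, *LWE with Side Information:
  Attacks and Concrete Security Estimation*, CRYPTO 2020; full version ePrint 2020/292 (held: paper:url-368cae305cdd),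
  §2 p. 6 L56–64 (volume, dual, Lemmas 9–10), p. 7 L1–4 (Definition 11), L10–22 (Lemma 12 and its proof), L23–29
  (Lemma 13).
* [DucasVanwoerden2021] L. Ducas, W. van Woerden, *NTRU Fatigue: How Stretched is Overstretched?*, ASIACRYPT 2021,
  LNCS 13093, §3 Lemma 3.2 (restates Lemma 12; held chunk p0026 L9).
* H. Cohen, *A Course in Computational Algebraic Number Theory*, GTM 138, Prop. 2.5.4 (Gram–Schmidt volume formula) —
  the tree's `covolume_latticeOfBasis_eq_prod_norm_gramSchmidt`.
-/

noncomputable section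

open Module Submodule MeasureTheory InnerProductSpace Finset
open scoped RealInnerProductSpace

namespace Literature.Algebra.EuclideanLattices

section Defs

variable {E : Type*} [NormedAddCommGroup E] [InnerProductSpace ℝ E]

/-- **Primitive vector** ([DachmanSoledDucasGongRossi2020] Definition 11, case `k = 1`): `y ∈ Λ` is primitive with
respect to `Λ` iff `y/i ∉ Λ` for every integer `i ≥ 2` (equivalently, `y` extends to a basis of `Λ`; equivalently
`Λ ∩ Span(y) = ℤ y`). [cite: DachmanSoledDucasGongRossi2020, §2 Definition 11 (p. 7 L1–4)] -/
def IsPrimitiveVector (Λ : Submodule ℤ E) (y : E) : Prop :=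
  y ∈ Λ ∧ ∀ i : ℕ, 2 ≤ i → ((i : ℝ)⁻¹ • y) ∉ Λ

/-- **The slice `Λ ∩ v⊥`** of [DachmanSoledDucasGongRossi2020] Lemma 12, as a `ℤ`-submodule of the hyperplane
`v⊥ = (ℝ ∙ v)ᗮ` (a real inner product space in its own right): the vectors of the hyperplane that lie in `L`.
[cite: DachmanSoledDucasGongRossi2020, §2 Lemma 12 (p. 7 L10–13: «Λ' = (Λ ∩ v⊥) = {x ∈ Λ | ⟨x, v⟩ = 0}»)] -/
def slice (L : Submodule ℤ E) (v : E) : Submodule ℤ ↥(ℝ ∙ v)ᗮ :=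
  L.comap (((ℝ ∙ v)ᗮ).subtype.restrictScalars ℤ)

/-- Membership in the slice: a vector of `v⊥` is in `slice L v` iff it is in `L`.
[cite: DachmanSoledDucasGongRossi2020, §2 Lemma 12 (p. 7 L13)] -/
theorem mem_slice {L : Submodule ℤ E} {v : E} {x : ↥(ℝ ∙ v)ᗮ} : x ∈ slice L v ↔ (x : E) ∈ L :=
  Iff.rfl

/-- Elements of the hyperplane are orthogonal to `v`. [cite: DachmanSoledDucasGongRossi2020, §2 Lemma 12 (p. 7 L13)] -/
theorem inner_coe_orthogonal_singleton_eq_zero {v : E} (x : ↥(ℝ ∙ v)ᗮ) : ⟪v, (x : E)⟫ = 0 :=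
  (mem_orthogonal_singleton_iff_inner_right).1 x.2

/-- The slice is discrete (it embeds continuously and injectively into the discrete `L`).
[cite: DachmanSoledDucasGongRossi2020, §2 Lemma 12 («Λ ∩ v⊥ is a lattice»)] -/
theorem discreteTopology_slice (L : Submodule ℤ E) [DiscreteTopology L] (v : E) :
    DiscreteTopology (slice L v) := by
  let f : slice L v → L := fun x => ⟨((x : ↥(ℝ ∙ v)ᗮ) : E), mem_slice.1 x.2⟩
  have hc : Continuous f :=
    (continuous_subtype_val.comp continuous_subtype_val).subtype_mk _
  have hinj : Function.Injective f := by
    intro x y hxy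
    apply Subtype.ext
    apply Subtype.ext
    exact congrArg (fun z : L => (z : E)) hxy
  exact DiscreteTopology.of_continuous_injective hc hinj

end Defs

section Lattice

variable {E : Type*} [NormedAddCommGroup E] [InnerProductSpace ℝ E] [FiniteDimensional ℝ E]
variable (L : Submodule ℤ E) [DiscreteTopology L] [IsZLattice ℝ L]

omit [FiniteDimensional ℝ E] in
/-- A non-zero vector pairs non-trivially with some lattice vector (the lattice spans `E`).
[cite: DachmanSoledDucasGongRossi2020, §2 (p. 6: «A lattice is full rank if n = m»)] -/
theorem exists_mem_inner_ne_zero {v : E} (hv0 : v ≠ 0) : ∃ y ∈ L, ⟪v, y⟫ ≠ 0 := by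
  by_contra h
  push Not at h
  have hspan : Set.EqOn (innerₛₗ ℝ v) (0 : E →ₗ[ℝ] ℝ) (span ℝ (L : Set E) : Set E) :=
    LinearMap.eqOn_span (fun y hy => by simpa using h y hy)
  have hvv : ⟪v, v⟫ = 0 := by
    have hmem : v ∈ (span ℝ (L : Set E) : Set E) := by
      rw [IsZLattice.span_top (L := L)]
      trivial
    simpa using hspan hmem
  exact hv0 (inner_self_eq_zero.1 hvv)

omit [FiniteDimensional ℝ E] in
/-- **`⟨v, Λ⟩ = ℤ` for `v` primitive in `Λ*`**: if `v ≠ 0` is a primitive vector of the dual lattice `L*`, some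
`x ∈ L` has `⟪v, x⟫ = 1`. (The subgroup `⟨v, L⟩ ⊆ ℤ` is `ℓℤ` with `ℓ ≥ 1`; then `v/ℓ ∈ L*`, so `ℓ = 1` by
primitivity — the argument printed in the proof of the paper's Lemma 13.)
[cite: DachmanSoledDucasGongRossi2020, §2 Definition 11 and proof of Lemma 13 (p. 7 L26–28)] -/
theorem exists_inner_eq_one_of_isPrimitiveVector {v : E} (hv : IsPrimitiveVector (dualLattice L) v)
    (hv0 : v ≠ 0) : ∃ x ∈ L, ⟪v, x⟫ = 1 := by
  have hint : ∀ y ∈ L, ∃ n : ℤ, (n : ℝ) = ⟪v, y⟫ := mem_dualLattice.1 hv.1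
  -- the subgroup `G = ⟨v, L⟩` of `ℤ`
  let G : AddSubgroup ℤ :=
    { carrier := {n : ℤ | ∃ y ∈ L, (n : ℝ) = ⟪v, y⟫}
      zero_mem' := ⟨0, L.zero_mem, by simp⟩
      add_mem' := by
        rintro a b ⟨y, hy, hay⟩ ⟨z, hz, hbz⟩
        exact ⟨y + z, L.add_mem hy hz, by rw [Int.cast_add, inner_add_right, hay, hbz]⟩
      neg_mem' := by
        rintro a ⟨y, hy, hay⟩
        exact ⟨-y, L.neg_mem hy, by rw [Int.cast_neg, inner_neg_right, hay]⟩ }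
  have hGmem : ∀ y ∈ L, ∃ n : ℤ, n ∈ G ∧ (n : ℝ) = ⟪v, y⟫ := fun y hy => by
    obtain ⟨n, hn⟩ := hint y hy
    exact ⟨n, ⟨y, hy, hn⟩, hn⟩
  obtain ⟨a, ha⟩ := Int.subgroup_cyclic G
  -- `ℓ = |a|` generates `G`
  set ℓ : ℕ := a.natAbs with hℓ
  have hdvd : ∀ n ∈ G, (ℓ : ℤ) ∣ n := by
    intro n hn
    rw [ha, AddSubgroup.mem_closure_singleton] at hn
    obtain ⟨k, rfl⟩ := hn
    rw [hℓ, Int.natAbs_dvd, smul_eq_mul]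
    exact Dvd.intro_left k rfl
  have haG : a ∈ G := by
    rw [ha]
    exact AddSubgroup.subset_closure rfl
  have hℓG : (ℓ : ℤ) ∈ G := by
    rcases Int.natAbs_eq a with h | h
    · rw [hℓ, ← h]
      exact haG
    · rw [hℓ, show ((a.natAbs : ℕ) : ℤ) = -a by omega]
      exact G.neg_mem haG
  obtain ⟨y₀, hy₀L, hy₀⟩ := hℓG
  -- `ℓ ≠ 0`
  have hℓ0 : ℓ ≠ 0 := by
    intro h0
    obtain ⟨y, hy, hvy⟩ := exists_mem_inner_ne_zero L hv0
    obtain ⟨n, hnG, hn⟩ := hGmem y hy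
    have := hdvd n hnG
    rw [h0, Nat.cast_zero, zero_dvd_iff] at this
    rw [this, Int.cast_zero] at hn
    exact hvy hn.symm
  -- `ℓ = 1`, for otherwise `v/ℓ ∈ L*` contradicts primitivity
  have hℓ1 : ℓ = 1 := by
    by_contra hne
    have h2 : 2 ≤ ℓ := by omega
    refine hv.2 ℓ h2 (mem_dualLattice.2 fun y hy => ?_)
    obtain ⟨n, hnG, hn⟩ := hGmem y hy
    obtain ⟨q, hq⟩ := hdvd n hnG
    refine ⟨q, ?_⟩
    rw [real_inner_smul_left, ← hn, hq, Int.cast_mul, Int.cast_natCast, ← mul_assoc,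
      inv_mul_cancel₀ (by exact_mod_cast hℓ0), one_mul]
  refine ⟨y₀, hy₀L, ?_⟩
  rw [← hy₀, hℓ1, Nat.cast_one, Int.cast_one]

/-- **`Λ ∩ v⊥` is a lattice** (of full rank in the hyperplane `v⊥`) for every non-zero `v ∈ Λ*`: with `y ∈ L`,
`⟪v, y⟫ = ℓ ≠ 0`, every `x ∈ L` satisfies `ℓ x − ⟪v, x⟫ y ∈ L ∩ v⊥`, so `E = span L ⊆ span(L ∩ v⊥) + ℝ y` and
`span(L ∩ v⊥)` has dimension `n − 1 = dim v⊥`.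
[cite: DachmanSoledDucasGongRossi2020, §2 Lemma 12 («Then Λ ∩ v⊥ is a lattice», p. 7 L11)] -/
theorem isZLattice_slice {v : E} (hv : v ∈ dualLattice L) (hv0 : v ≠ 0) [DiscreteTopology (slice L v)] :
    IsZLattice ℝ (slice L v) := by
  refine ⟨?_⟩
  obtain ⟨y, hyL, hvy⟩ := exists_mem_inner_ne_zero L hv0
  obtain ⟨nℓ, hnℓ⟩ := mem_dualLattice.1 hv y hyL
  have hnℓ0 : (nℓ : ℝ) ≠ 0 := by rw [hnℓ]; exact hvy
  have hy0 : y ≠ 0 := by rintro rfl; simp at hvy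
  -- `S` = the real span of the slice, seen in `E`
  set H : Submodule ℝ E := (ℝ ∙ v)ᗮ with hH
  set S : Submodule ℝ E := (span ℝ (slice L v : Set ↥(ℝ ∙ v)ᗮ)).map ((ℝ ∙ v)ᗮ).subtype with hS
  -- every lattice vector lies in `S + ℝ y`
  have hLS : ∀ x ∈ L, x ∈ S ⊔ (ℝ ∙ y) := by
    intro x hx
    obtain ⟨nx, hnx⟩ := mem_dualLattice.1 hv x hx
    -- `z = nℓ x − nx y ∈ L ∩ v⊥`
    have hzL : (nℓ : ℝ) • x - (nx : ℝ) • y ∈ L := by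
      rw [Int.cast_smul_eq_zsmul, Int.cast_smul_eq_zsmul]
      exact L.sub_mem (L.smul_mem nℓ hx) (L.smul_mem nx hyL)
    have hzH : (nℓ : ℝ) • x - (nx : ℝ) • y ∈ (ℝ ∙ v)ᗮ := by
      rw [mem_orthogonal_singleton_iff_inner_right, inner_sub_right, real_inner_smul_right,
        real_inner_smul_right, ← hnx, ← hnℓ]
      ring
    have hzS : (nℓ : ℝ) • x - (nx : ℝ) • y ∈ S := by
      refine ⟨⟨_, hzH⟩, ?_, rfl⟩
      exact subset_span (show (⟨_, hzH⟩ : ↥(ℝ ∙ v)ᗮ) ∈ slice L v from hzL)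
    have hx_eq : x = (nℓ : ℝ)⁻¹ • (((nℓ : ℝ) • x - (nx : ℝ) • y) + (nx : ℝ) • y) := by
      rw [sub_add_cancel, smul_smul, inv_mul_cancel₀ hnℓ0, one_smul]
    rw [hx_eq]
    exact Submodule.smul_mem _ _ (Submodule.add_mem _ (Submodule.mem_sup_left hzS)
      (Submodule.mem_sup_right (Submodule.smul_mem _ _ (Submodule.mem_span_singleton_self y))))
  -- hence `E = S + ℝ y`
  have htop : (⊤ : Submodule ℝ E) ≤ S ⊔ (ℝ ∙ y) := by
    rw [← IsZLattice.span_top (L := L), span_le]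
    exact fun x hx => hLS x hx
  -- dimension count
  have hdimE : finrank ℝ (ℝ ∙ v) + finrank ℝ ↥(ℝ ∙ v)ᗮ = finrank ℝ E :=
    Submodule.finrank_add_finrank_orthogonal _
  rw [finrank_span_singleton hv0] at hdimE
  have hdimsup : finrank ℝ ↥(S ⊔ (ℝ ∙ y)) = finrank ℝ E := by
    rw [eq_top_iff.2 htop, finrank_top]
  have hdim2 := Submodule.finrank_sup_add_finrank_inf_eq S (ℝ ∙ y)
  rw [hdimsup, finrank_span_singleton hy0] at hdim2
  have hSH : S ≤ (ℝ ∙ v)ᗮ := Submodule.map_subtype_le _ _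
  have hdimS : finrank ℝ S = finrank ℝ ↥(ℝ ∙ v)ᗮ := by
    refine le_antisymm (Submodule.finrank_mono hSH) ?_
    omega
  have hSeq : S = (ℝ ∙ v)ᗮ := Submodule.eq_of_le_of_finrank_eq hSH hdimS
  -- pull back to the hyperplane
  refine Submodule.map_injective_of_injective ((ℝ ∙ v)ᗮ).injective_subtype ?_
  rw [Submodule.map_subtype_top, ← hS, hSeq]

end Lattice

/-! ### Lemma 12: the volume of the slice -/

section Volume

variable {E : Type*} [NormedAddCommGroup E] [InnerProductSpace ℝ E] [FiniteDimensional ℝ E]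
  [MeasurableSpace E] [BorelSpace E]
variable (L : Submodule ℤ E) [DiscreteTopology L] [IsZLattice ℝ L]

/-- **[DachmanSoledDucasGongRossi2020] Lemma 12 (Volume of a lattice slice).** Let `L` be a full-rank lattice of
the `n`-dimensional real inner product space `E`, and `v ∈ L*` with `⟨v, L⟩ = ℤ` (i.e. `v` primitive in `L*`,
`exists_inner_eq_one_of_isPrimitiveVector`). Then the slice `L ∩ v⊥`, a full-rank lattice of the hyperplane `v⊥`
(`isZLattice_slice`), has volume `vol(L ∩ v⊥) = ‖v‖ · vol(L)` — volumes being Mathlib's `ZLattice.covolume` for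
the Lebesgue measures of `v⊥` and of `E`. Proof by a unimodular complement `x₁` (`⟪v, x₁⟫ = 1`) and the
Gram–Schmidt volume formula (see the module docstring; the paper argues by duality).
[cite: DachmanSoledDucasGongRossi2020, §2 Lemma 12 (p. 7 L10–22)] -/
theorem covolume_slice {v : E} (hv : v ∈ dualLattice L) (hv1 : ∃ x ∈ L, ⟪v, x⟫ = 1)
    [DiscreteTopology (slice L v)] [IsZLattice ℝ (slice L v)] :
    ZLattice.covolume (slice L v) = ‖v‖ * ZLattice.covolume L := by
  classical
  obtain ⟨x₁, hx₁L, hx₁⟩ := hv1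
  have hv0 : v ≠ 0 := by
    rintro rfl
    simp at hx₁
  have hvn : 0 < ‖v‖ := norm_pos_iff.2 hv0
  have hx₁H : x₁ ∉ (ℝ ∙ v)ᗮ := by
    rw [mem_orthogonal_singleton_iff_inner_right, hx₁]
    exact one_ne_zero
  -- Step 1: a `ℤ`-basis of the slice, which is an `ℝ`-basis of the hyperplane
  have hrank : finrank ℤ (slice L v) = finrank ℝ ↥(ℝ ∙ v)ᗮ := ZLattice.rank ℝ (slice L v)
  obtain ⟨m, hm⟩ : ∃ m : ℕ, finrank ℝ ↥(ℝ ∙ v)ᗮ = m := ⟨_, rfl⟩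
  let bK : Basis (Fin m) ℤ (slice L v) := Module.finBasisOfFinrankEq ℤ (slice L v) (hrank.trans hm)
  let bH : Basis (Fin m) ℝ ↥(ℝ ∙ v)ᗮ := bK.ofZLatticeBasis ℝ (slice L v)
  have hbH : ∀ i, bH i = (bK i : ↥(ℝ ∙ v)ᗮ) := fun i => Basis.ofZLatticeBasis_apply ℝ (slice L v) bK i
  -- the slice vectors seen in `E`
  let k : Fin m → E := fun i => ((bK i : ↥(ℝ ∙ v)ᗮ) : E)
  have hk_eq : k = ((ℝ ∙ v)ᗮ).subtypeₗᵢ ∘ (⇑bH) := by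
    funext i
    simp [k, hbH]
  have hkL : ∀ i, k i ∈ L := fun i => mem_slice.1 (bK i).2
  have hkH : ∀ i, k i ∈ (ℝ ∙ v)ᗮ := fun i => (bK i : ↥(ℝ ∙ v)ᗮ).2
  -- `span ℝ k = v⊥`
  have hk_eq' : k = ((ℝ ∙ v)ᗮ).subtype ∘ (⇑bH) := hk_eq
  have hspan_k : span ℝ (Set.range k) = (ℝ ∙ v)ᗮ := by
    rw [hk_eq', Set.range_comp, ← Submodule.map_span, bH.span_eq, Submodule.map_subtype_top]
  -- Step 2: the extended family `c = (k, x₁)` is an `ℝ`-basis of `E`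
  let c : Fin (m + 1) → E := Fin.snoc k x₁
  have hc_cast : c ∘ Fin.castSucc = k := by
    funext i
    simp [c]
  have hc_last : c (Fin.last m) = x₁ := by simp [c]
  have hk_li : LinearIndependent ℝ k := by
    rw [hk_eq]
    exact bH.linearIndependent.map' _ (LinearMap.ker_eq_bot_of_injective ((ℝ ∙ v)ᗮ).subtypeₗᵢ.injective)
  have hc_li : LinearIndependent ℝ c := by
    refine linearIndependent_finSnoc.2 ⟨hk_li, ?_⟩
    rw [hspan_k]
    exact hx₁H
  have hcard : Fintype.card (Fin (m + 1)) = finrank ℝ E := by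
    have h := Submodule.finrank_add_finrank_orthogonal (ℝ ∙ v)
    rw [finrank_span_singleton hv0, hm] at h
    rw [Fintype.card_fin]
    omega
  let bE : Basis (Fin (m + 1)) ℝ E := basisOfLinearIndependentOfCardEqFinrank hc_li hcard
  have hbE : ⇑bE = c := coe_basisOfLinearIndependentOfCardEqFinrank hc_li hcard
  -- Step 3: `L = span ℤ c`
  have hLc : L = span ℤ (Set.range c) := by
    apply le_antisymm
    · intro x hx
      obtain ⟨nx, hnx⟩ := mem_dualLattice.1 hv x hx
      -- `x - nx • x₁ ∈ L ∩ v⊥`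
      have hzL : x - (nx : ℝ) • x₁ ∈ L := by
        rw [Int.cast_smul_eq_zsmul]
        exact L.sub_mem hx (L.smul_mem nx hx₁L)
      have hzH : x - (nx : ℝ) • x₁ ∈ (ℝ ∙ v)ᗮ := by
        rw [mem_orthogonal_singleton_iff_inner_right, inner_sub_right, real_inner_smul_right, ← hnx, hx₁]
        ring
      have hzK : (⟨_, hzH⟩ : ↥(ℝ ∙ v)ᗮ) ∈ slice L v := hzL
      -- expand on the `ℤ`-basis `bK`
      have hz_span : x - (nx : ℝ) • x₁ ∈ span ℤ (Set.range k) := by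
        set z : slice L v := ⟨⟨x - (nx : ℝ) • x₁, hzH⟩, hzK⟩ with hz
        have hzE : ((z : ↥(ℝ ∙ v)ᗮ) : E) = x - (nx : ℝ) • x₁ := rfl
        rw [← hzE, ← bK.sum_repr z]
        simp only [Submodule.coe_sum, Submodule.coe_smul_of_tower]
        exact Submodule.sum_mem _ fun i _ => Submodule.smul_mem _ _ (subset_span ⟨i, rfl⟩)
      have hk_sub : span ℤ (Set.range k) ≤ span ℤ (Set.range c) := by
        refine span_mono ?_
        rintro _ ⟨i, rfl⟩
        exact ⟨Fin.castSucc i, by rw [← hc_cast]; rfl⟩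
      have hx₁c : x₁ ∈ span ℤ (Set.range c) := subset_span ⟨Fin.last m, hc_last⟩
      have hx_eq : x = (x - (nx : ℝ) • x₁) + nx • x₁ := by
        rw [← Int.cast_smul_eq_zsmul ℝ nx x₁, sub_add_cancel]
      rw [hx_eq]
      exact Submodule.add_mem _ (hk_sub hz_span) (Submodule.smul_mem _ nx hx₁c)
    · rw [span_le]
      rintro _ ⟨i, rfl⟩
      refine Fin.lastCases ?_ (fun j => ?_) i
      · rw [SetLike.mem_coe, hc_last]
        exact hx₁L
      · rw [SetLike.mem_coe, show c (Fin.castSucc j) = k j from congrFun hc_cast j]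
        exact hkL j
  -- Step 4: `covol(L) = ∏ ‖c*ᵢ‖`
  have hcovL : ZLattice.covolume L = ∏ i, ‖gramSchmidt ℝ c i‖ := by
    have key : ∀ (M : Submodule ℤ E) [DiscreteTopology M] [IsZLattice ℝ M],
        M = Literature.Computability.Cryptography.latticeOfBasis bE →
          ZLattice.covolume M = ∏ i, ‖gramSchmidt ℝ (⇑bE) i‖ := by
      intro M _ _ hM
      subst hM
      exact covolume_latticeOfBasis_eq_prod_norm_gramSchmidt bE
    rw [← hbE]
    refine key L ?_
    rw [hLc]
    change _ = span ℤ (Set.range ⇑bE)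
    rw [hbE]
  -- Step 5: `covol(slice) = ∏ ‖k*ᵢ‖` (computed in the hyperplane, transported to `E`)
  have hcovK : ZLattice.covolume (slice L v) = ∏ i, ‖gramSchmidt ℝ k i‖ := by
    have key : ∀ (M : Submodule ℤ ↥(ℝ ∙ v)ᗮ) [DiscreteTopology M] [IsZLattice ℝ M],
        M = Literature.Computability.Cryptography.latticeOfBasis bH →
          ZLattice.covolume M = ∏ i, ‖gramSchmidt ℝ (⇑bH) i‖ := by
      intro M _ _ hM
      subst hM
      exact covolume_latticeOfBasis_eq_prod_norm_gramSchmidt bH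
    have hKb : slice L v = Literature.Computability.Cryptography.latticeOfBasis bH :=
      (Basis.ofZLatticeBasis_span ℝ (slice L v) bK).symm
    rw [key (slice L v) hKb]
    refine Finset.prod_congr rfl fun i _ => ?_
    rw [← ((ℝ ∙ v)ᗮ).subtypeₗᵢ.norm_map,
      ← Literature.Analysis.InnerProduct.gramSchmidt_map_linearIsometry ℝ ((ℝ ∙ v)ᗮ).subtypeₗᵢ (⇑bH) i,
      ← hk_eq]
  -- Step 6: the Gram–Schmidt vectors of `c`: the first `m` are those of `k`, the last is `v/‖v‖²`
  have hGS_cast : ∀ j : Fin m, gramSchmidt ℝ c (Fin.castSucc j) = gramSchmidt ℝ k j := by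
    intro j
    rw [← Literature.Analysis.InnerProduct.gramSchmidt_comp_castSucc, hc_cast]
  have hGS_last : gramSchmidt ℝ c (Fin.last m) = (‖v‖ ^ 2)⁻¹ • v := by
    rw [Literature.Analysis.InnerProduct.gramSchmidt_last_eq_sub_starProjection, hc_cast, hc_last, hspan_k]
    have h1 : x₁ - ((ℝ ∙ v)ᗮ).starProjection x₁ = (ℝ ∙ v).starProjection x₁ := by
      rw [sub_eq_iff_eq_add]
      exact (starProjection_add_starProjection_orthogonal (K := ℝ ∙ v) x₁).symm
    rw [h1, starProjection_singleton, hx₁]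
    simp
  have hnorm_last : ‖gramSchmidt ℝ c (Fin.last m)‖ = ‖v‖⁻¹ := by
    rw [hGS_last, norm_smul, norm_inv, norm_pow, Real.norm_eq_abs, abs_norm, pow_two, mul_inv,
      mul_assoc, inv_mul_cancel₀ hvn.ne', mul_one]
  -- Step 7: assemble
  rw [hcovL, Fin.prod_univ_castSucc, hnorm_last, hcovK]
  simp_rw [hGS_cast]
  field_simp

/-- **Lemma 12 with the printed hypothesis** «`v` a primitive vector with respect to `Λ*`» (Definition 11).
[cite: DachmanSoledDucasGongRossi2020, §2 Lemma 12 (p. 7 L10–22)] -/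
theorem covolume_slice_of_isPrimitiveVector {v : E} (hv : IsPrimitiveVector (dualLattice L) v) (hv0 : v ≠ 0)
    [DiscreteTopology (slice L v)] [IsZLattice ℝ (slice L v)] :
    ZLattice.covolume (slice L v) = ‖v‖ * ZLattice.covolume L :=
  covolume_slice L hv.1 (exists_inner_eq_one_of_isPrimitiveVector L hv hv0)

end Volume

/-! ### Lemma 13: the volume of a sparsified lattice -/

section Sparsified

variable {E : Type*} [NormedAddCommGroup E] [InnerProductSpace ℝ E]

/-- **The sparsified lattice `Λ' = {x ∈ Λ | ⟨x, v⟩ ≡ 0 mod k}`** of [DachmanSoledDucasGongRossi2020] Lemma 13, for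
`v ∈ Λ*` (so that `⟨x, v⟩ ∈ ℤ`) and an integer `k`: the vectors of `L` whose (integer) pairing with `v` is divisible
by `k`. [cite: DachmanSoledDucasGongRossi2020, §2 Lemma 13 (p. 7 L23–25)] -/
def sparsify (L : Submodule ℤ E) (v : E) (k : ℕ) : Submodule ℤ E where
  carrier := {x : E | x ∈ L ∧ ∃ n : ℤ, (n : ℝ) * k = ⟪v, x⟫}
  zero_mem' := ⟨L.zero_mem, 0, by simp⟩
  add_mem' := by
    rintro x y ⟨hx, n, hn⟩ ⟨hy, n', hn'⟩
    exact ⟨L.add_mem hx hy, n + n', by rw [inner_add_right, ← hn, ← hn', Int.cast_add, add_mul]⟩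
  smul_mem' := by
    rintro c x ⟨hx, n, hn⟩
    refine ⟨L.smul_mem c hx, c * n, ?_⟩
    rw [← Int.cast_smul_eq_zsmul ℝ c x, real_inner_smul_right, ← hn, Int.cast_mul, mul_assoc]

/-- Membership in the sparsified lattice. [cite: DachmanSoledDucasGongRossi2020, §2 Lemma 13 (p. 7 L24)] -/
theorem mem_sparsify {L : Submodule ℤ E} {v : E} {k : ℕ} {x : E} :
    x ∈ sparsify L v k ↔ x ∈ L ∧ ∃ n : ℤ, (n : ℝ) * k = ⟪v, x⟫ :=
  Iff.rfl

/-- `Λ' ⊆ Λ`. [cite: DachmanSoledDucasGongRossi2020, §2 Lemma 13 («a sublattice of Λ», p. 7 L24)] -/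
theorem sparsify_le (L : Submodule ℤ E) (v : E) (k : ℕ) : sparsify L v k ≤ L := fun _ hx => hx.1

/-- `k Λ ⊆ Λ'` (for `v ∈ Λ*`). [cite: DachmanSoledDucasGongRossi2020, §2 Lemma 13 (p. 7 L23–25)] -/
theorem natCast_smul_mem_sparsify {L : Submodule ℤ E} {v : E} (hv : v ∈ dualLattice L) (k : ℕ) {x : E}
    (hx : x ∈ L) : (k : ℤ) • x ∈ sparsify L v k := by
  obtain ⟨n, hn⟩ := mem_dualLattice.1 hv x hx
  refine ⟨L.smul_mem _ hx, n, ?_⟩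
  rw [← Int.cast_smul_eq_zsmul ℝ, real_inner_smul_right, ← hn, Int.cast_natCast, mul_comm]

/-- The sparsified lattice is discrete. [cite: DachmanSoledDucasGongRossi2020, §2 Lemma 13 (p. 7 L24)] -/
theorem discreteTopology_sparsify (L : Submodule ℤ E) [DiscreteTopology L] (v : E) (k : ℕ) :
    DiscreteTopology (sparsify L v k) := by
  let f : sparsify L v k → L := fun x => ⟨(x : E), (sparsify_le L v k) x.2⟩
  have hc : Continuous f := continuous_subtype_val.subtype_mk _
  have hinj : Function.Injective f := by
    intro x y hxy
    exact Subtype.ext (congrArg (fun z : L => (z : E)) hxy)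
  exact DiscreteTopology.of_continuous_injective hc hinj

/-- For `k ≥ 1` and `v ∈ Λ*`, the sparsified lattice has full rank (it contains `k Λ`).
[cite: DachmanSoledDucasGongRossi2020, §2 Lemma 13 («a sublattice of Λ», p. 7 L24)] -/
theorem isZLattice_sparsify (L : Submodule ℤ E) [DiscreteTopology L] [IsZLattice ℝ L] {v : E}
    (hv : v ∈ dualLattice L) {k : ℕ} (hk : k ≠ 0) [DiscreteTopology (sparsify L v k)] :
    IsZLattice ℝ (sparsify L v k) := by
  refine ⟨?_⟩
  rw [eq_top_iff, ← IsZLattice.span_top (L := L), span_le]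
  intro x hx
  have hkx : (k : ℤ) • x ∈ span ℝ (sparsify L v k : Set E) := subset_span (natCast_smul_mem_sparsify hv k hx)
  have hx_eq : x = (k : ℝ)⁻¹ • ((k : ℤ) • x) := by
    rw [← Int.cast_smul_eq_zsmul ℝ, Int.cast_natCast, smul_smul, inv_mul_cancel₀ (by exact_mod_cast hk), one_smul]
  rw [SetLike.mem_coe, hx_eq]
  exact Submodule.smul_mem _ _ hkx

variable [FiniteDimensional ℝ E] [MeasurableSpace E] [BorelSpace E]

/-- **[DachmanSoledDucasGongRossi2020] Lemma 13 (Volume of a sparsified lattice).** Let `L` be a full-rank lattice,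
`v ∈ L*` with `⟨v, L⟩ = ℤ` (i.e. `v` primitive in `L*`, `exists_inner_eq_one_of_isPrimitiveVector`) and `k > 0` an
integer. Then `Λ' = {x ∈ Λ | ⟨x, v⟩ ≡ 0 mod k}` has volume `vol(Λ') = k · vol(Λ)`. Proof as printed: the group
morphism `φ : x ∈ Λ ↦ ⟨x, v⟩ mod k` is surjective with kernel `Λ'`, so `|Λ/Λ'| = |ℤ_k| = k`; the index is the
ratio of covolumes (Mathlib `ZLattice.covolume_div_covolume_eq_relIndex'`).
[cite: DachmanSoledDucasGongRossi2020, §2 Lemma 13 (p. 7 L23–29)] -/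
theorem covolume_sparsify (L : Submodule ℤ E) [DiscreteTopology L] [IsZLattice ℝ L] {v : E}
    (hv : v ∈ dualLattice L) (hv1 : ∃ x ∈ L, ⟪v, x⟫ = 1) {k : ℕ} (hk : k ≠ 0)
    [DiscreteTopology (sparsify L v k)] [IsZLattice ℝ (sparsify L v k)] :
    ZLattice.covolume (sparsify L v k) = k * ZLattice.covolume L := by
  classical
  obtain ⟨x₁, hx₁L, hx₁⟩ := hv1
  -- the integer pairing `x ↦ ⟨v, x⟩` on `L`, reduced mod `k`
  have hint : ∀ x : L, ∃ n : ℤ, (n : ℝ) = ⟪v, (x : E)⟫ := fun x => mem_dualLattice.1 hv x x.2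
  choose N hN using hint
  have hN_add : ∀ x y : L, N (x + y) = N x + N y := fun x y => by
    have h : ((N (x + y) : ℤ) : ℝ) = ((N x + N y : ℤ) : ℝ) := by
      rw [hN, Int.cast_add, hN, hN, Submodule.coe_add, inner_add_right]
    exact_mod_cast h
  let φ : L →+ ZMod k :=
    { toFun := fun x => ((N x : ℤ) : ZMod k)
      map_zero' := by
        have h0 : N 0 = 0 := by
          have h : ((N 0 : ℤ) : ℝ) = ((0 : ℤ) : ℝ) := by rw [hN]; simp
          exact_mod_cast h
        simp [h0]
      map_add' := fun x y => by simp [hN_add] }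
  -- `φ` is surjective: `φ (n • x₁) = n`
  have hφsurj : Function.Surjective φ := by
    intro t
    refine ⟨(t.val : ℤ) • ⟨x₁, hx₁L⟩, ?_⟩
    have hNx₁ : N ⟨x₁, hx₁L⟩ = 1 := by
      have h : ((N ⟨x₁, hx₁L⟩ : ℤ) : ℝ) = ((1 : ℤ) : ℝ) := by rw [hN]; simpa using hx₁
      exact_mod_cast h
    haveI : NeZero k := ⟨hk⟩
    rw [map_zsmul]
    change (t.val : ℤ) • ((N ⟨x₁, hx₁L⟩ : ℤ) : ZMod k) = t
    rw [hNx₁, Int.cast_one, zsmul_eq_mul, mul_one, Int.cast_natCast, ZMod.natCast_zmod_val]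
  -- `ker φ = Λ'` (as a subgroup of `L`)
  have hker : (sparsify L v k).toAddSubgroup.addSubgroupOf L.toAddSubgroup = φ.ker := by
    ext x
    rw [AddSubgroup.mem_addSubgroupOf, AddMonoidHom.mem_ker]
    change (x : E) ∈ sparsify L v k ↔ ((N x : ℤ) : ZMod k) = 0
    rw [mem_sparsify, ZMod.intCast_zmod_eq_zero_iff_dvd]
    constructor
    · rintro ⟨-, n, hn⟩
      refine ⟨n, ?_⟩
      have h : ((N x : ℤ) : ℝ) = ((k * n : ℤ) : ℝ) := by rw [hN, ← hn]; push_cast; ring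
      exact_mod_cast h
    · rintro ⟨n, hn⟩
      refine ⟨x.2, n, ?_⟩
      rw [← hN x, hn]
      push_cast
      ring
  -- the index is `k`
  have hindex : (sparsify L v k).toAddSubgroup.relIndex L.toAddSubgroup = k := by
    rw [AddSubgroup.relIndex, hker, AddSubgroup.index_ker, AddMonoidHom.range_eq_top_of_surjective _ hφsurj,
      AddSubgroup.card_top, Nat.card_zmod]
  -- covolume ratio = index
  have hratio := ZLattice.covolume_div_covolume_eq_relIndex' (sparsify L v k) L (sparsify_le L v k)
  rw [hindex, div_eq_iff (ZLattice.covolume_pos L volume).ne'] at hratio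
  exact hratio

/-- **Lemma 13 with the printed hypothesis** «`v ∈ Λ*` a primitive vector of `Λ*`» (Definition 11).
[cite: DachmanSoledDucasGongRossi2020, §2 Lemma 13 (p. 7 L23–29)] -/
theorem covolume_sparsify_of_isPrimitiveVector (L : Submodule ℤ E) [DiscreteTopology L] [IsZLattice ℝ L]
    {v : E} (hv : IsPrimitiveVector (dualLattice L) v) (hv0 : v ≠ 0) {k : ℕ} (hk : k ≠ 0)
    [DiscreteTopology (sparsify L v k)] [IsZLattice ℝ (sparsify L v k)] :
    ZLattice.covolume (sparsify L v k) = k * ZLattice.covolume L :=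
  covolume_sparsify L hv.1 (exists_inner_eq_one_of_isPrimitiveVector L hv hv0) hk

end Sparsified

end Literature.Algebra.EuclideanLattices
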